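import Summits.CriticalPhenomena.PercolationContinuityZ3.Theorems.PercNearOneGluingNoHeavyLowerTailSunflowerGraphCoreTriangle
import HarnessLib

/-!
# `NoHeavyLowerTail` (crux stmt-CriticalPhenomena-4575), abstract sunflower cubic: THE FANS ARE NOT A-SAFE (an infinite family)

Support file (seat `prim-ineq-prove-1` gen 39; `--supports stmt-CriticalPhenomena-4575`).  No `sorry`, no named facts.  Memo:
run/shared/lean/prim/prim-ineq-prove-1/FINDING-GRAPHCORES-prove1-g39.md §4.

The **fan core** on the points `Fin (k+3)` (hub `0`, leaves `i ≠ 0`, at least two leaves):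
`fanCore k = {ω | (0 ∈ ω ∧ some leaf ∈ ω) ∨ every leaf ∈ ω}` = `x₀(x₁ ∨ … ∨ x_{k+2}) ∨ x₁x₂⋯x_{k+2}`; for `k = 0` this is
`maj₃ = x₀x₁ ∨ x₀x₂ ∨ x₁x₂`.  THEOREM `not_aSafe_fanCore`: **for every `k`, the fan core is not A-safe** (`∃ p, ¬ Safe p (fanCore k)`).
Witness (memo §4, the census witnesses generalised): `p₀ = t^{k+1}`, `p_leaf = t`, `t = 1/(2(k+3)²)`, and the three PRINCIPAL petals
`{0 ∈ ω}`, `{all leaves but the last ∈ ω}`, `{last leaf ∈ ω}` (pairwise unions contain a generator, so they meet inside the core):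
`∏ μ(petal) = t^{k+1}·t^{k+1}·t = t^{2k+3}` while `μ(fanCore) ≤ (k+2)·t^{k+1}·t + t^{k+2} = (k+3)t^{k+2}` (union bound), and
`((k+3)t^{k+2})² = ½·t^{2k+3} < t^{2k+3}`.  On paper (memo §4) every proper minor of a fan is read-once, hence safe: the fans are an
infinite antichain of EXCLUDED MINORS for A-safety (cf. `aSafe_delMinor`, `aSafe_conMinor` in `…SunflowerSafeMinors`).
-/

noncomputable section

namespace Summit.CriticalPhenomena.PercolationContinuityZ3.Theorems.SunflowerPartition

namespace SafeCalc

open MeasureTheory Finset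
open Literature.Probability.LatticeModels Literature.Probability.Percolation

/-- The **fan core** on `Fin (k+3)`: hub `0` together with some leaf, or all the leaves. [this work] -/
def fanCore (k : ℕ) : Set (Set (Fin (k + 3))) := {ω | (0 ∈ ω ∧ ∃ i, i ≠ 0 ∧ i ∈ ω) ∨ ∀ i, i ≠ 0 → i ∈ ω}

/-- The fan core is an up-set. [this work] -/
theorem isUpperSet_fanCore (k : ℕ) : IsUpperSet (fanCore k) := by
  rintro ω ω' hle (⟨h0, i, hi, hiω⟩ | h)
  · exact Or.inl ⟨hle h0, i, hi, hle hiω⟩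
  · exact Or.inr fun i hi => hle (h i hi)

/-- The witness parameter `t = 1 / (2 (k+3)²)`. [this work] -/
def fanT (k : ℕ) : ℝ := 1 / (2 * ((k : ℝ) + 3) ^ 2)

/-- The witness parameter is positive. [this work] -/
theorem fanT_pos (k : ℕ) : 0 < fanT k := by
  unfold fanT; positivity

/-- The witness parameter is at most one. [this work] -/
theorem fanT_le_one (k : ℕ) : fanT k ≤ 1 := by
  unfold fanT
  rw [div_le_one (by positivity)]
  nlinarith [sq_nonneg ((k : ℝ) + 3), (by positivity : (0 : ℝ) ≤ k)]

/-- The witness parameter vector: `t^{k+1}` on the hub, `t` on the leaves. [this work] -/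
def fanParam (k : ℕ) : Fin (k + 3) → unitInterval := fun i =>
  if i = 0 then ⟨fanT k ^ (k + 1), pow_nonneg (fanT_pos k).le _, pow_le_one₀ (fanT_pos k).le (fanT_le_one k)⟩
  else ⟨fanT k, (fanT_pos k).le, fanT_le_one k⟩

/-- **The fans are not A-safe.** [this work] -/
theorem not_aSafe_fanCore (k : ℕ) : ∃ p : Fin (k + 3) → unitInterval, ¬ Safe p (fanCore k) := by
  classical
  refine ⟨fanParam k, fun hsafe => ?_⟩
  set p := fanParam k with hp
  set t := fanT k with ht
  have ht0 : 0 < t := fanT_pos k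
  have hp0 : (p 0 : ℝ) = t ^ (k + 1) := by simp [hp, fanParam, ht]
  have hpi : ∀ i : Fin (k + 3), i ≠ 0 → (p i : ℝ) = t := by
    intro i hi; simp [hp, fanParam, hi, ht]
  set last : Fin (k + 3) := Fin.last (k + 2) with hlast
  have hlast0 : last ≠ 0 := by
    rw [hlast]; exact ne_of_gt (Fin.last_pos' )
  -- the leaves and the leaves other than the last one
  set L : Finset (Fin (k + 3)) := univ.erase 0 with hL
  set S : Finset (Fin (k + 3)) := L.erase last with hS
  have hcardL : L.card = k + 2 := by
    rw [hL, Finset.card_erase_of_mem (Finset.mem_univ _), Finset.card_univ, Fintype.card_fin]; rfl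
  have hlastL : last ∈ L := Finset.mem_erase.2 ⟨hlast0, Finset.mem_univ _⟩
  have hcardS : S.card = k + 1 := by
    rw [hS, Finset.card_erase_of_mem hlastL, hcardL]; rfl
  have hmemS : ∀ i, i ∈ S ↔ i ≠ 0 ∧ i ≠ last := by
    intro i
    rw [hS, Finset.mem_erase, hL, Finset.mem_erase]
    simp only [Finset.mem_univ, and_true]
    tauto
  -- a leaf different from the last one
  have hone0 : (1 : Fin (k + 3)) ≠ 0 := by
    intro h
    have := congrArg Fin.val h
    simp at this
  have honeLast : (1 : Fin (k + 3)) ≠ last := by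
    intro h
    have := congrArg Fin.val h
    rw [hlast, Fin.val_last, Fin.val_one] at this
    omega
  -- the three principal petals
  let V : Fin 3 → Set (Set (Fin (k + 3))) := ![{ω | (0 : Fin (k + 3)) ∈ ω}, {ω | (↑S : Set (Fin (k + 3))) ⊆ ω}, {ω | last ∈ ω}]
  have hV0 : V 0 = {ω | (0 : Fin (k + 3)) ∈ ω} := rfl
  have hV1 : V 1 = {ω | (↑S : Set (Fin (k + 3))) ⊆ ω} := rfl
  have hV2 : V 2 = {ω | last ∈ ω} := rfl
  have hV : ∀ i, IsUpperSet (V i) := by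
    intro i
    fin_cases i
    · exact fun ω ω' hle (hω : (0 : Fin (k + 3)) ∈ ω) => hle hω
    · exact fun ω ω' hle (hω : (↑S : Set (Fin (k + 3))) ⊆ ω) => hω.trans hle
    · exact fun ω ω' hle (hω : last ∈ ω) => hle hω
  have hS1 : ∀ ω : Set (Fin (k + 3)), (↑S : Set (Fin (k + 3))) ⊆ ω → (1 : Fin (k + 3)) ∈ ω :=
    fun ω h => h (Finset.mem_coe.2 ((hmemS 1).2 ⟨hone0, honeLast⟩))
  have hSall : ∀ ω : Set (Fin (k + 3)), (↑S : Set (Fin (k + 3))) ⊆ ω → last ∈ ω → ∀ i, i ≠ 0 → i ∈ ω := by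
    intro ω h hl i hi
    by_cases hil : i = last
    · rw [hil]; exact hl
    · exact h (Finset.mem_coe.2 ((hmemS i).2 ⟨hi, hil⟩))
  have hcap : ∀ i j, i ≠ j → V i ∩ V j ⊆ fanCore k := by
    intro i j hij ω hω
    fin_cases i <;> fin_cases j
    · exact absurd rfl hij
    · exact Or.inl ⟨hω.1, 1, hone0, hS1 ω hω.2⟩
    · exact Or.inl ⟨hω.1, last, hlast0, hω.2⟩
    · exact Or.inl ⟨hω.2, 1, hone0, hS1 ω hω.1⟩
    · exact absurd rfl hij
    · exact Or.inr (hSall ω hω.1 hω.2)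
    · exact Or.inl ⟨hω.2, last, hlast0, hω.1⟩
    · exact Or.inr (hSall ω hω.2 hω.1)
    · exact absurd rfl hij
  have key := hsafe 3 V hV hcap
  have hVS : (prodBernoulli p).real {ω | (↑S : Set (Fin (k + 3))) ⊆ ω} = t ^ (k + 1) := by
    rw [prodBernoulli_real_subset, Finset.prod_congr rfl fun i hi => hpi i ((hmemS i).1 hi).1, Finset.prod_const, hcardS]
  rw [Fin.prod_univ_three, hV0, hV1, hV2, prodBernoulli_real_setOf_mem, prodBernoulli_real_setOf_mem, hVS, hp0,
    hpi last hlast0] at key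
  -- upper bound for the core: hub with some leaf (union bound over the leaves), or all leaves
  have hsub : fanCore k ⊆ (⋃ i ∈ L, pairEv 0 i) ∪ {ω | (↑L : Set (Fin (k + 3))) ⊆ ω} := by
    rintro ω (⟨h0, i, hi, hiω⟩ | h)
    · left
      exact Set.mem_biUnion (Finset.mem_coe.2 (Finset.mem_erase.2 ⟨hi, Finset.mem_univ _⟩)) ⟨h0, hiω⟩
    · right
      intro i hi
      exact h i (Finset.mem_erase.1 (Finset.mem_coe.1 hi)).1
  have hpair : ∀ i ∈ L, (prodBernoulli p).real (pairEv 0 i) = t ^ (k + 1) * t := by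
    intro i hi
    have hi0 : i ≠ 0 := (Finset.mem_erase.1 hi).1
    rw [real_pairEv p hi0.symm, hp0, hpi i hi0]
  have hVL : (prodBernoulli p).real {ω | (↑L : Set (Fin (k + 3))) ⊆ ω} = t ^ (k + 2) := by
    rw [prodBernoulli_real_subset, Finset.prod_congr rfl fun i hi => hpi i (Finset.mem_erase.1 hi).1, Finset.prod_const,
      hcardL]
  have hF : (prodBernoulli p).real (fanCore k) ≤ ((k : ℝ) + 3) * t ^ (k + 2) := by
    calc (prodBernoulli p).real (fanCore k)
        ≤ (prodBernoulli p).real ((⋃ i ∈ L, pairEv 0 i) ∪ {ω | (↑L : Set (Fin (k + 3))) ⊆ ω}) := measureReal_mono hsub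
      _ ≤ (prodBernoulli p).real (⋃ i ∈ L, pairEv 0 i) + (prodBernoulli p).real {ω | (↑L : Set (Fin (k + 3))) ⊆ ω} :=
          measureReal_union_le _ _
      _ ≤ (∑ i ∈ L, (prodBernoulli p).real (pairEv 0 i)) + t ^ (k + 2) := by
          rw [hVL]; gcongr; exact measureReal_biUnion_finset_le L _
      _ = (∑ i ∈ L, t ^ (k + 1) * t) + t ^ (k + 2) := by rw [Finset.sum_congr rfl hpair]
      _ = ((k : ℝ) + 3) * t ^ (k + 2) := by
          rw [Finset.sum_const, hcardL, nsmul_eq_mul]; push_cast; ring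
  -- the contradiction: t^{2k+3} ≤ ((k+3) t^{k+2})^2 = ((k+3)^2 t) · t^{2k+3} = t^{2k+3} / 2
  have hF0 : 0 ≤ (prodBernoulli p).real (fanCore k) := measureReal_nonneg
  have h1 : t ^ (k + 1) * t ^ (k + 1) * t ≤ (((k : ℝ) + 3) * t ^ (k + 2)) ^ 2 :=
    key.trans (pow_le_pow_left₀ hF0 hF 2)
  have hkt : ((k : ℝ) + 3) ^ 2 * t = 1 / 2 := by
    rw [ht]; unfold fanT; field_simp
  have h2 : (((k : ℝ) + 3) * t ^ (k + 2)) ^ 2 = (1 / 2) * (t ^ (k + 1) * t ^ (k + 1) * t) := by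
    rw [← hkt]; ring
  have h3 : 0 < t ^ (k + 1) * t ^ (k + 1) * t := by positivity
  nlinarith [h1, h2, h3]

/-- For `k = 0` the fan core is the majority core `maj₃ = x₀x₁ ∨ x₀x₂ ∨ x₁x₂` (the graph core of a triangle). [this work] -/
theorem fanCore_zero_eq_maj : fanCore 0 = {ω | (0 ∈ ω ∧ (1 : Fin 3) ∈ ω) ∨ (0 ∈ ω ∧ (2 : Fin 3) ∈ ω) ∨ ((1 : Fin 3) ∈ ω ∧ (2 : Fin 3) ∈ ω)} := by
  ext ω
  simp only [fanCore, Set.mem_setOf_eq]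
  constructor
  · rintro (⟨h0, i, hi, hiω⟩ | h)
    · fin_cases i
      · exact absurd rfl hi
      · exact Or.inl ⟨h0, hiω⟩
      · exact Or.inr (Or.inl ⟨h0, hiω⟩)
    · exact Or.inr (Or.inr ⟨h 1 (by decide), h 2 (by decide)⟩)
  · rintro (⟨h0, h1⟩ | ⟨h0, h2⟩ | ⟨h1, h2⟩)
    · exact Or.inl ⟨h0, 1, by decide, h1⟩
    · exact Or.inl ⟨h0, 2, by decide, h2⟩
    · refine Or.inr fun i hi => ?_
      fin_cases i
      · exact absurd rfl hi
      · exact h1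
      · exact h2

end SafeCalc

end Summit.CriticalPhenomena.PercolationContinuityZ3.Theorems.SunflowerPartition
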